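import Summits.RiemannHypothesis.RiemannHypothesis.Theorems.UniversalFactorWideTailStandalone

/-!
# RiemannHypothesis / UniversalFactor — `WideKernelTail` in the route decl's spelling, route-file-independent

Route `RiemannHypothesis/UniversalFactor`, item `WideKernelTail` (stmt-RiemannHypothesis-14036, formerly
stmt-RiemannHypothesis-2581). The item is PROVED in the tree twice — by seat 0's `wideKernelTail`
(`UniversalFactorLaplaceLoopholeWideTail.lean`, convolution + dominated convergence) and by
`UniversalFactorStandalone.tendsto_exp_mul_deBruijnHDiv_laplace` (`UniversalFactorWideTailStandalone.lean`,
variation of constants) — but only a module that does NOT import the route file can be linked by the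
gate as `WideKernelTail_holds` without an import cycle. This file is such a module: it restates the
standalone tail in the exact spelling of the route decl's body (`(Real.exp (a * x) : ℂ)` instead of
`Complex.exp (a x)`), so that `example : UniversalFactor.WideKernelTail := UniversalFactorStandalone.wideKernelTail`
elaborates (checked, 2026-08-16).
-/

noncomputable section

namespace Summit.RiemannHypothesis.RiemannHypothesis.Theorems

open Filter
open scoped Topology
open Literature.NumberTheory.LFunctions

/-- **`WideKernelTail`** (the body of the route decl, verbatim): for `0 < a < π/8`,
`e^{ax} F_a(x) → a ∫₀^∞ H_0(y) cosh(ay) dy` as `x → +∞`, where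
`F_a = deBruijnHDiv (fun u ↦ 1 + u²/a²)`. From
`UniversalFactorStandalone.tendsto_exp_mul_deBruijnHDiv_laplace` (`↑(Real.exp (a x)) = Complex.exp (a x)`).
[folklore] -/
theorem UniversalFactorStandalone.wideKernelTail :
    ∀ a : ℝ, 0 < a → a < Real.pi / 8 → Filter.Tendsto (fun x : ℝ => (Real.exp (a * x) : ℂ) *
        Literature.NumberTheory.LFunctions.deBruijnHDiv (fun u : ℝ => 1 + u ^ 2 / a ^ 2) (x : ℂ))
      Filter.atTop (nhds ((a : ℂ) * ∫ y in Set.Ioi (0:ℝ),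
        Literature.NumberTheory.LFunctions.deBruijnH 0 (y : ℂ) * (Real.cosh (a * y) : ℂ))) := by
  intro a ha hlt
  refine (UniversalFactorStandalone.tendsto_exp_mul_deBruijnHDiv_laplace ha hlt).congr fun x ↦ ?_
  rw [Complex.ofReal_exp]
  push_cast
  ring_nf

end Summit.RiemannHypothesis.RiemannHypothesis.Theorems
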